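import Mathlib.Analysis.SpecialFunctions.SmoothTransition
import Mathlib.Analysis.SpecialFunctions.Pow.Deriv
import Mathlib.Analysis.Calculus.FDeriv.Equiv
import Mathlib.Analysis.InnerProductSpace.Harmonic.Basic
import Literature.Analysis.FluidPDE.RadialCalculus
import Literature.Analysis.FluidPDE.NormalisedPressure
import Literature.Analysis.FluidPDE.TaoEnergyLocalisation
import HarnessLib

/-!
# The Newtonian kernel on `ℝ³`, radial cutoffs, and the near/far splitting

Analysis/FluidPDE support file for the discharge of Tao's pressure-normalisation lemma
(`FluidPDE/NormalisedPressureProofs`, Tao 2011 Lemma 4.1 (i)): kernel-level calculus for the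
singular-integral representation of the normalised pressure `-Δ⁻¹∂ᵢ∂ⱼ(uᵢuⱼ)`.

* `Literature.NS.radialCutoff r₀ r₁`: a smooth **radial** cutoff on a real inner product space, equal to
  `1` on the closed ball of radius `r₀` and to `0` outside the open ball of radius `r₁`
  (`z ↦ smoothTransition ((r₁² - ‖z‖²)/(r₁² - r₀²))`; Mathlib's `ContDiffBump` is not provably
  radial, its base being chosen by `Nonempty.some`). It is the tree's `Literature.Analysis.FluidPDE.taoCutoff`
  (`FluidPDE/TaoEnergyLocalisation`) in the two-radii parametrisation:
  `radialCutoff r₀ r₁ = taoCutoff r₁ ((r₁² - r₀²)/r₁)` (`radialCutoff_eq_taoCutoff`); the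
  parametrisation by the two radii is the one in which the scaling
  `θ_{Rr₀,Rr₁}(z) = θ_{r₀,r₁}(R⁻¹z)` (`radialCutoff_scale`) is literal.
* `Literature.Analysis.FluidPDE.fderiv_homogeneous`, `Literature.Analysis.FluidPDE.norm_le_of_homogeneous`: derivatives of functions
  homogeneous of degree `m` are homogeneous of degree `m - 1`; a continuous function homogeneous
  of non-positive degree is bounded off a ball by its bound on a sphere.
* `Literature.NS.newtonKernel z = Γ(z) = -1/(4π|z|)` on `ℝ³` (the fundamental solution, `ΔΓ = δ₀`;
  Gilbarg–Trudinger (2.12) with `n = 3`, `ω₃ = 4π/3`: `Γ(x) = |x|^{2-n}/(n(2-n)ωₙ) = -1/(4π|x|)`),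
  written as the radial profile `newtonProfile σ = -(4π)⁻¹ σ^{-1/2}` of `σ = |z|²`; its first and
  second derivatives away from the origin (Gilbarg–Trudinger (2.13): `DΓ(z) = z/(4π|z|³)`,
  `D²Γ(z)(a,b) = (⟨a,b⟩|z|² - 3⟨z,a⟩⟨z,b⟩)/(4π|z|⁵)`, so `D²Γ(z)(a,a) = -K(z)(a)` with `K` the
  pressure kernel of `FluidPDE/NormalisedPressure`), harmonicity `ΔΓ = 0` off the origin
  (Gilbarg–Trudinger, the sentence after (2.12)), the bounds `|Γ| = (4π|z|)⁻¹`,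
  `‖DΓ‖ ≤ (4π|z|²)⁻¹`, `‖D²Γ‖ ≤ (π|z|³)⁻¹` (the shape of Gilbarg–Trudinger (2.14)), and
  homogeneity of all `fderiv`-iterates.
* the splitting `Γ = Γ₀ + Γ∞`, `Γ₀ = θΓ` (`newtonNear`, compactly supported; that it is in
  `L¹` is proved in `NewtonPotential`), `Γ∞ = (1-θ)Γ` (`newtonFar`, smooth with all
  `fderiv`-iterates up to order four bounded), `ΔΓ = 0` off the origin in Mathlib's vocabulary
  (`harmonicOnNhd_newtonKernel`), and `λ = ΔΓ∞` (`newtonFarLaplacian`, smooth, with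
  topological support in the annulus `r₀ ≤ |z| ≤ r₁`, and `ΔΓ₀ = -λ` off the origin; the
  integrated form of the distributional identity `Δ(θΓ) = δ₀ - λ` is in `NewtonPotential`).

## References

* D. Gilbarg, N. S. Trudinger, *Elliptic partial differential equations of second order*
  (Springer, 2001 reprint), (2.12)–(2.14), (4.9)–(4.10).
* E. M. Stein, *Singular integrals and differentiability properties of functions* (1970),
  Ch. III §1.
* T. Tao, *Localisation and compactness properties of the Navier–Stokes global regularity
  problem*, Anal. PDE 6 (2013) = arXiv:1108.1165, §4.
-/

noncomputable section

open MeasureTheory Set Filter Metric Topology InnerProductSpace Function Real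
open scoped RealInnerProductSpace Laplacian ContDiff

namespace Literature.Analysis.FluidPDE

/-! ### A radial smooth cutoff -/

section Cutoff

variable {E : Type*} [NormedAddCommGroup E]

/-- The profile (in the variable `σ = |z|²`) of the radial cutoff:
`Θ(σ) = smoothTransition ((r₁² - σ)/(r₁² - r₀²))`. [folklore] -/
def cutoffProfile (r₀ r₁ : ℝ) (σ : ℝ) : ℝ :=
  Real.smoothTransition ((r₁ ^ 2 - σ) / (r₁ ^ 2 - r₀ ^ 2))

/-- **Radial smooth cutoff** `θ(z) = Θ(|z|²)`: smooth, radial, `0 ≤ θ ≤ 1`, `θ = 1` on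
`|z| ≤ r₀` and `θ = 0` on `|z| ≥ r₁` (for `0 ≤ r₀ < r₁`). [folklore] -/
def radialCutoff (r₀ r₁ : ℝ) (z : E) : ℝ :=
  cutoffProfile r₀ r₁ (‖z‖ ^ 2)

/-- The cutoff profile is smooth. [folklore] -/
theorem cutoffProfile_contDiff (r₀ r₁ : ℝ) {n : ℕ∞} : ContDiff ℝ n (cutoffProfile r₀ r₁) :=
  Real.smoothTransition.contDiff.comp ((contDiff_const.sub contDiff_id).div_const _)

/-- The cutoff profile is non-negative. [folklore] -/
theorem cutoffProfile_nonneg (r₀ r₁ σ : ℝ) : 0 ≤ cutoffProfile r₀ r₁ σ :=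
  Real.smoothTransition.nonneg _

/-- The cutoff profile is at most one. [folklore] -/
theorem cutoffProfile_le_one (r₀ r₁ σ : ℝ) : cutoffProfile r₀ r₁ σ ≤ 1 :=
  Real.smoothTransition.le_one _

/-- `Θ(σ) = 1` for `σ ≤ r₀²`. [folklore] -/
theorem cutoffProfile_eq_one {r₀ r₁ σ : ℝ} (h₀ : 0 ≤ r₀) (h₁ : r₀ < r₁) (hσ : σ ≤ r₀ ^ 2) :
    cutoffProfile r₀ r₁ σ = 1 := by
  have hd : 0 < r₁ ^ 2 - r₀ ^ 2 := by nlinarith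
  refine Real.smoothTransition.one_of_one_le ?_
  rw [le_div_iff₀ hd]
  linarith

/-- `Θ(σ) = 0` for `r₁² ≤ σ`. [folklore] -/
theorem cutoffProfile_eq_zero {r₀ r₁ σ : ℝ} (h₀ : 0 ≤ r₀) (h₁ : r₀ < r₁) (hσ : r₁ ^ 2 ≤ σ) :
    cutoffProfile r₀ r₁ σ = 0 := by
  have hd : 0 < r₁ ^ 2 - r₀ ^ 2 := by nlinarith
  exact Real.smoothTransition.zero_of_nonpos (div_nonpos_of_nonpos_of_nonneg (by linarith) hd.le)

/-- The radial cutoff is smooth (on an inner product space, where `‖·‖²` is smooth). [folklore] -/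
theorem radialCutoff_contDiff {E' : Type*} [NormedAddCommGroup E'] [InnerProductSpace ℝ E']
    (r₀ r₁ : ℝ) {n : ℕ∞} : ContDiff ℝ n (radialCutoff r₀ r₁ : E' → ℝ) :=
  (cutoffProfile_contDiff r₀ r₁).comp (contDiff_norm_sq ℝ)

/-- `0 ≤ θ`. [folklore] -/
theorem radialCutoff_nonneg (r₀ r₁ : ℝ) (z : E) : 0 ≤ radialCutoff r₀ r₁ z :=
  cutoffProfile_nonneg _ _ _

/-- `θ ≤ 1`. [folklore] -/
theorem radialCutoff_le_one (r₀ r₁ : ℝ) (z : E) : radialCutoff r₀ r₁ z ≤ 1 :=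
  cutoffProfile_le_one _ _ _

/-- `|θ| ≤ 1`. [folklore] -/
theorem abs_radialCutoff_le_one (r₀ r₁ : ℝ) (z : E) : |radialCutoff r₀ r₁ z| ≤ 1 := by
  rw [abs_of_nonneg (radialCutoff_nonneg _ _ _)]
  exact radialCutoff_le_one _ _ _

/-- The cutoff is radial. [folklore] -/
theorem radialCutoff_radial (r₀ r₁ : ℝ) {x y : E} (h : ‖x‖ = ‖y‖) :
    radialCutoff r₀ r₁ x = radialCutoff r₀ r₁ y := by
  simp only [radialCutoff, h]

/-- `θ = 1` on the closed ball of radius `r₀`. [folklore] -/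
theorem radialCutoff_eq_one {r₀ r₁ : ℝ} (h₀ : 0 ≤ r₀) (h₁ : r₀ < r₁) {z : E} (hz : ‖z‖ ≤ r₀) :
    radialCutoff r₀ r₁ z = 1 :=
  cutoffProfile_eq_one h₀ h₁ (pow_le_pow_left₀ (norm_nonneg _) hz 2)

/-- `θ = 0` off the open ball of radius `r₁`. [folklore] -/
theorem radialCutoff_eq_zero {r₀ r₁ : ℝ} (h₀ : 0 ≤ r₀) (h₁ : r₀ < r₁) {z : E} (hz : r₁ ≤ ‖z‖) :
    radialCutoff r₀ r₁ z = 0 :=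
  cutoffProfile_eq_zero h₀ h₁ (pow_le_pow_left₀ (h₀.trans h₁.le) hz 2)

/-- `θ = 1` near every point of the open ball of radius `r₀`. [folklore] -/
theorem radialCutoff_eventuallyEq_one {r₀ r₁ : ℝ} (h₀ : 0 ≤ r₀) (h₁ : r₀ < r₁) {z : E}
    (hz : ‖z‖ < r₀) : (radialCutoff r₀ r₁ : E → ℝ) =ᶠ[𝓝 z] fun _ => 1 := by
  have : ball (0 : E) r₀ ∈ 𝓝 z := isOpen_ball.mem_nhds (mem_ball_zero_iff.2 hz)
  filter_upwards [this] with w hw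
  exact radialCutoff_eq_one h₀ h₁ (mem_ball_zero_iff.1 hw).le

/-- `θ = 0` near every point off the closed ball of radius `r₁`. [folklore] -/
theorem radialCutoff_eventuallyEq_zero {r₀ r₁ : ℝ} (h₀ : 0 ≤ r₀) (h₁ : r₀ < r₁) {z : E}
    (hz : r₁ < ‖z‖) : (radialCutoff r₀ r₁ : E → ℝ) =ᶠ[𝓝 z] fun _ => 0 := by
  have : (closedBall (0 : E) r₁)ᶜ ∈ 𝓝 z :=
    isClosed_closedBall.isOpen_compl.mem_nhds (by simpa using hz)
  filter_upwards [this] with w hw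
  simp only [mem_compl_iff, mem_closedBall_zero_iff, not_le] at hw
  exact radialCutoff_eq_zero h₀ h₁ hw.le

/-- The topological support of `θ` lies in the closed ball of radius `r₁`. [folklore] -/
theorem tsupport_radialCutoff_subset {r₀ r₁ : ℝ} (h₀ : 0 ≤ r₀) (h₁ : r₀ < r₁) :
    tsupport (radialCutoff r₀ r₁ : E → ℝ) ⊆ closedBall 0 r₁ := by
  refine closure_minimal (fun z hz => ?_) isClosed_closedBall
  rw [mem_closedBall_zero_iff]
  by_contra h
  exact hz (radialCutoff_eq_zero h₀ h₁ (not_le.1 h).le)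

/-- `θ` has compact support (proper space). [folklore] -/
theorem hasCompactSupport_radialCutoff [ProperSpace E] {r₀ r₁ : ℝ}
    (h₀ : 0 ≤ r₀) (h₁ : r₀ < r₁) : HasCompactSupport (radialCutoff r₀ r₁ : E → ℝ) :=
  (isCompact_closedBall (0 : E) r₁).of_isClosed_subset isClosed_closure
    (tsupport_radialCutoff_subset h₀ h₁)

/-- **Bridge to the tree's `taoCutoff`**: `radialCutoff r₀ r₁ = taoCutoff r₁ ((r₁² - r₀²)/r₁)` for
`r₁ ≠ 0` (same `smoothTransition` profile; the two stacks differ only in the parametrisation of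
the annulus). [folklore] -/
theorem radialCutoff_eq_taoCutoff {r₀ r₁ : ℝ} (h : r₁ ≠ 0) (z : E) :
    radialCutoff r₀ r₁ z = taoCutoff r₁ ((r₁ ^ 2 - r₀ ^ 2) / r₁) z := by
  unfold radialCutoff cutoffProfile taoCutoff
  congr 1
  rw [div_mul_cancel₀ _ h]

/-- Scaling: `θ_{Rr₀,Rr₁}(z) = θ_{r₀,r₁}(R⁻¹z)`. [folklore] -/
theorem radialCutoff_scale [NormedSpace ℝ E] {r₀ r₁ R : ℝ} (hR : 0 < R) (z : E) :
    radialCutoff (R * r₀) (R * r₁) z = radialCutoff r₀ r₁ (R⁻¹ • z) := by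
  simp only [radialCutoff, cutoffProfile, norm_smul, Real.norm_eq_abs, abs_inv, abs_of_pos hR]
  congr 1
  have hR2 : R ^ 2 ≠ 0 := by positivity
  field_simp

end Cutoff

/-! ### Homogeneous functions -/

section Homogeneous

variable {E : Type*} [NormedAddCommGroup E] [NormedSpace ℝ E]
variable {F : Type*} [NormedAddCommGroup F] [NormedSpace ℝ F]

omit [NormedSpace ℝ E] in
/-- `(‖z‖²)ᵗ = ‖z‖^{2t}` (any seminormed group). [folklore] -/
theorem norm_sq_rpow (z : E) (t : ℝ) : (‖z‖ ^ 2) ^ t = ‖z‖ ^ (2 * t) := by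
  rw [← Real.rpow_natCast ‖z‖ 2, ← Real.rpow_mul (norm_nonneg z)]
  norm_num

/-- **Derivatives of homogeneous functions are homogeneous.** If `Φ(c z) = c^m Φ(z)` for all
`c > 0` and all `z`, then `DΦ(c z) = c^{m-1} DΦ(z)` for all `c > 0` and all `z` (no
differentiability hypothesis: both sides vanish where `Φ` is not differentiable; the homothety
is Mathlib's `ContinuousLinearEquiv.smulLeft (Units.mk0 c _)`). [folklore] -/
theorem fderiv_homogeneous (Φ : E → F) (m : ℤ)
    (hΦ : ∀ c : ℝ, 0 < c → ∀ z, Φ (c • z) = c ^ m • Φ z) (c : ℝ) (hc : 0 < c) (z : E) :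
    fderiv ℝ Φ (c • z) = c ^ (m - 1) • fderiv ℝ Φ z := by
  set L : E ≃L[ℝ] E := ContinuousLinearEquiv.smulLeft (M₁ := E) (R₁ := ℝ) (Units.mk0 c hc.ne')
    with hL
  have hLz : ∀ w, L w = c • w := fun w => by simp [hL, Units.smul_def]
  have h1 : Φ ∘ L = c ^ m • Φ := by
    funext w
    simp [hLz, hΦ c hc w]
  have h2 := L.comp_right_fderiv (f := Φ) (x := z)
  rw [h1, fderiv_const_smul_field] at h2
  simp only [Pi.smul_apply] at h2
  -- `h2 : c ^ m • fderiv ℝ Φ z = (fderiv ℝ Φ (c • z)).comp L`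
  have h3 : (fderiv ℝ Φ (L z)).comp (L : E →L[ℝ] E) = c • fderiv ℝ Φ (c • z) := by
    ext w
    simp [hLz]
  rw [h3] at h2
  have h4 : fderiv ℝ Φ (c • z) = c⁻¹ • (c ^ m • fderiv ℝ Φ z) := by
    rw [h2, smul_smul, inv_mul_cancel₀ hc.ne', one_smul]
  rw [h4, smul_smul, ← zpow_neg_one, ← zpow_add₀ hc.ne', neg_add_eq_sub]

/-- A function homogeneous of degree `m ≤ 0` is bounded off the ball of radius `r` by its bound
on the sphere of radius `r`. [folklore] -/
theorem norm_le_of_homogeneous (Φ : E → F) (m : ℤ) (hm : m ≤ 0)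
    (hΦ : ∀ c : ℝ, 0 < c → ∀ z, Φ (c • z) = c ^ m • Φ z) {r M : ℝ} (hr : 0 < r)
    (hM : ∀ w, ‖w‖ = r → ‖Φ w‖ ≤ M) {z : E} (hz : r ≤ ‖z‖) : ‖Φ z‖ ≤ M := by
  have hz0 : 0 < ‖z‖ := hr.trans_le hz
  set c := ‖z‖ / r with hc
  have hc0 : 0 < c := div_pos hz0 hr
  have hc1 : 1 ≤ c := by rwa [hc, one_le_div hr]
  set w := c⁻¹ • z with hw
  have hwn : ‖w‖ = r := by
    rw [hw, norm_smul, norm_inv, Real.norm_eq_abs, abs_of_pos hc0, hc]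
    field_simp
  have hzw : z = c • w := by rw [hw, smul_smul, mul_inv_cancel₀ hc0.ne', one_smul]
  have hM0 : 0 ≤ M := (norm_nonneg _).trans (hM w hwn)
  rw [hzw, hΦ c hc0 w, norm_smul, norm_zpow, Real.norm_eq_abs, abs_of_pos hc0]
  calc c ^ m * ‖Φ w‖ ≤ 1 * M := by
        gcongr
        · exact zpow_le_one_of_nonpos₀ hc1 hm
        · exact hM w hwn
    _ = M := one_mul M

/-- A function that is continuous off the origin and homogeneous of degree `m ≤ 0` is bounded
off every ball centred at the origin (proper spaces: spheres are compact). [folklore] -/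
theorem exists_bound_of_homogeneous [ProperSpace E] (Φ : E → F) (m : ℤ) (hm : m ≤ 0)
    (hΦ : ∀ c : ℝ, 0 < c → ∀ z, Φ (c • z) = c ^ m • Φ z) (hc : ContinuousOn Φ {0}ᶜ)
    {r : ℝ} (hr : 0 < r) : ∃ M, ∀ z, r ≤ ‖z‖ → ‖Φ z‖ ≤ M := by
  have hs : sphere (0 : E) r ⊆ {0}ᶜ := fun w hw => by
    rw [mem_sphere_zero_iff_norm] at hw
    intro h0
    rw [mem_singleton_iff] at h0
    rw [h0, norm_zero] at hw
    exact hr.ne' hw.symm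
  obtain ⟨M, hM⟩ := (isCompact_sphere (0 : E) r).exists_bound_of_continuousOn (hc.mono hs)
  exact ⟨M, fun z hz => norm_le_of_homogeneous Φ m hm hΦ hr
    (fun w hw => hM w (mem_sphere_zero_iff_norm.2 hw)) hz⟩

end Homogeneous

/-! ### Smoothness of the Laplacian -/

section LaplacianSmooth

variable {E : Type*} [NormedAddCommGroup E] [InnerProductSpace ℝ E] [FiniteDimensional ℝ E]
variable {F : Type*} [NormedAddCommGroup F] [InnerProductSpace ℝ F]

/-- The Laplacian of a `C^{n+2}` function is `C^n`. [folklore] -/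
theorem contDiff_laplacian {f : E → F} {n : ℕ∞} (hf : ContDiff ℝ (n + 2) f) :
    ContDiff ℝ n (Δ f) := by
  rw [laplacian_eq_iteratedFDeriv_stdOrthonormalBasis]
  refine ContDiff.sum fun i _ => ?_
  have h2 : ContDiff ℝ n (iteratedFDeriv ℝ 2 f) := by
    refine hf.iteratedFDeriv_right (m := n) (i := 2) ?_
    exact le_of_eq (by norm_cast)
  exact (ContinuousMultilinearMap.apply ℝ (fun _ : Fin 2 => E) F
    ![stdOrthonormalBasis ℝ E i, stdOrthonormalBasis ℝ E i]).contDiff.comp h2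

end LaplacianSmooth

/-! ### The Newtonian kernel on `ℝ³` -/

section Newton

-- nested operator types `ℝ³ →L[ℝ] ℝ³ →L[ℝ] ℝ³ →L[ℝ] ℝ` (third and fourth derivatives)
set_option maxSynthPendingDepth 3

/-- Local notation for physical space `ℝ³ = EuclideanSpace ℝ (Fin 3)`. -/
local notation "ℝ³" => EuclideanSpace ℝ (Fin 3)

/-- The radial profile `γ(σ) = -(4π)⁻¹ σ^{-1/2}` of the Newtonian kernel (`Γ(z) = γ(|z|²)`). [folklore] -/
def newtonProfile (σ : ℝ) : ℝ := -(4 * π)⁻¹ * σ ^ (-(1 / 2 : ℝ))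

/-- `γ'(σ) = (8π)⁻¹ σ^{-3/2}`. [folklore] -/
def newtonProfile₁ (σ : ℝ) : ℝ := (8 * π)⁻¹ * σ ^ (-(3 / 2 : ℝ))

/-- `γ''(σ) = -(3/(16π)) σ^{-5/2}`. [folklore] -/
def newtonProfile₂ (σ : ℝ) : ℝ := -(3 / (16 * π)) * σ ^ (-(5 / 2 : ℝ))

/-- `γ' = γ₁` on `σ > 0`. [folklore] -/
theorem hasDerivAt_newtonProfile {σ : ℝ} (hσ : 0 < σ) :
    HasDerivAt newtonProfile (newtonProfile₁ σ) σ := by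
  have h : HasDerivAt newtonProfile
      (-(4 * π)⁻¹ * (-(1 / 2 : ℝ) * σ ^ (-(1 / 2 : ℝ) - 1))) σ :=
    (Real.hasDerivAt_rpow_const (p := -(1 / 2 : ℝ)) (Or.inl hσ.ne')).const_mul (-(4 * π)⁻¹)
  refine h.congr_deriv ?_
  rw [newtonProfile₁, show (-(1 / 2 : ℝ)) - 1 = -(3 / 2 : ℝ) by norm_num]
  ring

/-- `γ₁' = γ₂` on `σ > 0`. [folklore] -/
theorem hasDerivAt_newtonProfile₁ {σ : ℝ} (hσ : 0 < σ) :
    HasDerivAt newtonProfile₁ (newtonProfile₂ σ) σ := by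
  have h : HasDerivAt newtonProfile₁
      ((8 * π)⁻¹ * (-(3 / 2 : ℝ) * σ ^ (-(3 / 2 : ℝ) - 1))) σ :=
    (Real.hasDerivAt_rpow_const (p := -(3 / 2 : ℝ)) (Or.inl hσ.ne')).const_mul ((8 * π)⁻¹)
  refine h.congr_deriv ?_
  rw [newtonProfile₂, show (-(3 / 2 : ℝ)) - 1 = -(5 / 2 : ℝ) by norm_num]
  field_simp
  ring

/-- `γ` is smooth on `σ > 0`. [folklore] -/
theorem contDiffAt_newtonProfile {σ : ℝ} (hσ : 0 < σ) {n : WithTop ℕ∞} :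
    ContDiffAt ℝ n newtonProfile σ :=
  contDiffAt_const.mul (Real.contDiffAt_rpow_const_of_ne hσ.ne')

/-- **The Newtonian kernel** `Γ(z) = -1/(4π|z|)` on `ℝ³` (`ΔΓ = δ₀`; Gilbarg–Trudinger (2.12)
with `n = 3`), as the radial profile `γ(|z|²)`; junk value `0` at the origin. [folklore] -/
def newtonKernel (z : ℝ³) : ℝ := newtonProfile (‖z‖ ^ 2)

/-- `Γ(z) = -(4π|z|)⁻¹` (also at `z = 0`, where both sides are the junk value `0`). [folklore] -/
theorem newtonKernel_eq (z : ℝ³) : newtonKernel z = -(4 * π * ‖z‖)⁻¹ := by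
  rw [newtonKernel, newtonProfile, norm_sq_rpow, show (2 : ℝ) * -(1 / 2) = -1 by norm_num,
    Real.rpow_neg_one, mul_inv, mul_inv]
  ring

/-- `|Γ(z)| = (4π|z|)⁻¹`. [folklore] -/
theorem abs_newtonKernel (z : ℝ³) : |newtonKernel z| = (4 * π * ‖z‖)⁻¹ := by
  rw [newtonKernel_eq, abs_neg, abs_inv, abs_of_nonneg (by positivity)]

/-- `Γ` is homogeneous of degree `-1`: `Γ(cz) = c⁻¹ Γ(z)` for `c > 0`. [folklore] -/
theorem newtonKernel_smul {c : ℝ} (hc : 0 < c) (z : ℝ³) :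
    newtonKernel (c • z) = c⁻¹ * newtonKernel z := by
  rw [newtonKernel_eq, newtonKernel_eq, norm_smul, Real.norm_eq_abs, abs_of_pos hc]
  rw [mul_inv, mul_inv, mul_inv, mul_inv]
  ring

/-- `Γ` is smooth away from the origin. [folklore] -/
theorem contDiffAt_newtonKernel {z : ℝ³} (hz : z ≠ 0) {n : WithTop ℕ∞} :
    ContDiffAt ℝ n newtonKernel z :=
  (contDiffAt_newtonProfile (by positivity : 0 < ‖z‖ ^ 2)).comp z (contDiff_norm_sq ℝ).contDiffAt

/-- `Γ` is smooth on the complement of the origin. [folklore] -/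
theorem contDiffOn_newtonKernel {n : WithTop ℕ∞} : ContDiffOn ℝ n newtonKernel {0}ᶜ :=
  fun _ hz => (contDiffAt_newtonKernel hz).contDiffWithinAt

/-- `DΓ(z) = ⟨z, ·⟩/(4π|z|³)` for `z ≠ 0`. [folklore] -/
theorem hasFDerivAt_newtonKernel {z : ℝ³} (hz : z ≠ 0) :
    HasFDerivAt newtonKernel ((4 * π * ‖z‖ ^ 3)⁻¹ • (innerSL ℝ z : ℝ³ →L[ℝ] ℝ)) z := by
  have hσ : 0 < ‖z‖ ^ 2 := by positivity
  have h := hasFDerivAt_comp_norm_sq (E := ℝ³) (hasDerivAt_newtonProfile hσ)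
  have e : 2 * newtonProfile₁ (‖z‖ ^ 2) = (4 * π * ‖z‖ ^ 3)⁻¹ := by
    rw [newtonProfile₁, norm_sq_rpow, show (2 : ℝ) * -(3 / 2) = -3 by norm_num,
      Real.rpow_neg (norm_nonneg z), show (3 : ℝ) = ((3 : ℕ) : ℝ) by norm_num,
      Real.rpow_natCast]
    field_simp
    norm_num
  rw [e] at h
  exact h

/-- `DΓ(z) = ⟨z, ·⟩/(4π|z|³)` for `z ≠ 0` (`fderiv` form). [folklore] -/
theorem fderiv_newtonKernel {z : ℝ³} (hz : z ≠ 0) :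
    fderiv ℝ newtonKernel z = (4 * π * ‖z‖ ^ 3)⁻¹ • (innerSL ℝ z : ℝ³ →L[ℝ] ℝ) :=
  (hasFDerivAt_newtonKernel hz).fderiv

/-- `DΓ(z) a = ⟨z, a⟩/(4π|z|³)` for `z ≠ 0`. [folklore] -/
theorem fderiv_newtonKernel_apply {z : ℝ³} (hz : z ≠ 0) (a : ℝ³) :
    fderiv ℝ newtonKernel z a = ⟪z, a⟫ / (4 * π * ‖z‖ ^ 3) := by
  rw [fderiv_newtonKernel hz]
  simp [div_eq_inv_mul]

/-- `‖DΓ(z)‖ = (4π|z|²)⁻¹` for `z ≠ 0`. [folklore] -/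
theorem norm_fderiv_newtonKernel {z : ℝ³} (hz : z ≠ 0) :
    ‖fderiv ℝ newtonKernel z‖ = (4 * π * ‖z‖ ^ 2)⁻¹ := by
  have hz' : 0 < ‖z‖ := norm_pos_iff.2 hz
  rw [fderiv_newtonKernel hz, norm_smul, innerSL_apply_norm, norm_inv, Real.norm_eq_abs,
    abs_of_pos (by positivity)]
  have : ‖z‖ ≠ 0 := norm_ne_zero_iff.2 hz
  field_simp

/-- `D²Γ(z)(a,b) = (⟨a,b⟩|z|² - 3⟨z,a⟩⟨z,b⟩)/(4π|z|⁵)` for `z ≠ 0` (Gilbarg–Trudinger (2.13),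
the formula for `DᵢⱼΓ`). [folklore] -/
theorem fderiv_fderiv_newtonKernel_apply {z : ℝ³} (hz : z ≠ 0) (a b : ℝ³) :
    fderiv ℝ (fun w => fderiv ℝ newtonKernel w a) z b =
      (⟪a, b⟫ * ‖z‖ ^ 2 - 3 * ⟪z, a⟫ * ⟪z, b⟫) / (4 * π * ‖z‖ ^ 5) := by
  have hσ : 0 < ‖z‖ ^ 2 := by positivity
  have h := fderiv_fderiv_comp_norm_sq_apply (E := ℝ³) (g := newtonProfile)
    (g₁ := newtonProfile₁) (U := Ioi 0) isOpen_Ioi (fun σ hσ => hasDerivAt_newtonProfile hσ)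
    (z := z) hσ (hasDerivAt_newtonProfile₁ hσ) a b
  change fderiv ℝ (fun w => fderiv ℝ newtonKernel w a) z b = _ at h
  rw [h, newtonProfile₂, newtonProfile₁, norm_sq_rpow, norm_sq_rpow,
    show (2 : ℝ) * -(5 / 2) = -5 by norm_num, show (2 : ℝ) * -(3 / 2) = -3 by norm_num,
    Real.rpow_neg (norm_nonneg z), Real.rpow_neg (norm_nonneg z),
    show (3 : ℝ) = ((3 : ℕ) : ℝ) by norm_num, show (5 : ℝ) = ((5 : ℕ) : ℝ) by norm_num,
    Real.rpow_natCast, Real.rpow_natCast]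
  have : ‖z‖ ≠ 0 := norm_ne_zero_iff.2 hz
  field_simp
  ring

/-- `D²Γ(z)(a,a) = -K(z)(a)`, `K` the pressure kernel `(3⟨z,a⟩² - |a|²|z|²)/(4π|z|⁵)` of
`FluidPDE/NormalisedPressure` (Tao 2011, (35)). [folklore] -/
theorem fderiv_fderiv_newtonKernel_apply_self {z : ℝ³} (hz : z ≠ 0) (a : ℝ³) :
    fderiv ℝ (fun w => fderiv ℝ newtonKernel w a) z a = -pressureKernel z a := by
  rw [fderiv_fderiv_newtonKernel_apply hz, pressureKernel_eq_fin3, real_inner_self_eq_norm_sq]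
  ring

/-- `|D²Γ(z)(a,b)| ≤ |a||b|/(π|z|³)` for `z ≠ 0`. [folklore] -/
theorem abs_fderiv_fderiv_newtonKernel_apply_le {z : ℝ³} (hz : z ≠ 0) (a b : ℝ³) :
    |fderiv ℝ (fun w => fderiv ℝ newtonKernel w a) z b| ≤ ‖a‖ * ‖b‖ / (π * ‖z‖ ^ 3) := by
  have hz' : 0 < ‖z‖ := norm_pos_iff.2 hz
  rw [fderiv_fderiv_newtonKernel_apply hz, abs_div,
    abs_of_pos (by positivity : (0 : ℝ) < 4 * π * ‖z‖ ^ 5)]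
  have h1 : |⟪a, b⟫ * ‖z‖ ^ 2 - 3 * ⟪z, a⟫ * ⟪z, b⟫| ≤ 4 * (‖a‖ * ‖b‖ * ‖z‖ ^ 2) := by
    have i1 : |⟪a, b⟫| ≤ ‖a‖ * ‖b‖ := abs_real_inner_le_norm a b
    have i2 : |⟪z, a⟫| ≤ ‖z‖ * ‖a‖ := abs_real_inner_le_norm z a
    have i3 : |⟪z, b⟫| ≤ ‖z‖ * ‖b‖ := abs_real_inner_le_norm z b
    calc |⟪a, b⟫ * ‖z‖ ^ 2 - 3 * ⟪z, a⟫ * ⟪z, b⟫|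
        ≤ |⟪a, b⟫ * ‖z‖ ^ 2| + |3 * ⟪z, a⟫ * ⟪z, b⟫| := abs_sub _ _
      _ = |⟪a, b⟫| * ‖z‖ ^ 2 + 3 * (|⟪z, a⟫| * |⟪z, b⟫|) := by
          rw [abs_mul, abs_mul, abs_mul, abs_of_nonneg (by positivity : (0 : ℝ) ≤ ‖z‖ ^ 2)]
          norm_num
          ring
      _ ≤ ‖a‖ * ‖b‖ * ‖z‖ ^ 2 + 3 * (‖z‖ * ‖a‖ * (‖z‖ * ‖b‖)) := by
          gcongr
      _ = 4 * (‖a‖ * ‖b‖ * ‖z‖ ^ 2) := by ring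
  calc |⟪a, b⟫ * ‖z‖ ^ 2 - 3 * ⟪z, a⟫ * ⟪z, b⟫| / (4 * π * ‖z‖ ^ 5)
      ≤ 4 * (‖a‖ * ‖b‖ * ‖z‖ ^ 2) / (4 * π * ‖z‖ ^ 5) := by gcongr
    _ = ‖a‖ * ‖b‖ / (π * ‖z‖ ^ 3) := by
        field_simp

/-- **`Γ` is harmonic off the origin**: `ΔΓ(z) = 0` for `z ≠ 0` (Gilbarg–Trudinger, the sentence
after (2.12)). [folklore] -/
theorem laplacian_newtonKernel {z : ℝ³} (hz : z ≠ 0) : Δ newtonKernel z = 0 := by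
  have hσ : 0 < ‖z‖ ^ 2 := by positivity
  have h := laplacian_comp_norm_sq (E := ℝ³) (g := newtonProfile) (g₁ := newtonProfile₁)
    (U := Ioi 0) isOpen_Ioi (fun σ hσ => hasDerivAt_newtonProfile hσ) (z := z) hσ
    (hasDerivAt_newtonProfile₁ hσ)
  change Δ newtonKernel z = _ at h
  rw [h, finrank_euclideanSpace_fin, newtonProfile₂, newtonProfile₁]
  have e : (‖z‖ ^ 2) ^ (-(5 / 2 : ℝ)) * ‖z‖ ^ 2 = (‖z‖ ^ 2) ^ (-(3 / 2 : ℝ)) := by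
    rw [← Real.rpow_add_one hσ.ne']
    norm_num
  push_cast
  calc 4 * (-(3 / (16 * π)) * (‖z‖ ^ 2) ^ (-(5 / 2 : ℝ))) * ‖z‖ ^ 2 +
        2 * 3 * ((8 * π)⁻¹ * (‖z‖ ^ 2) ^ (-(3 / 2 : ℝ)))
      = -(3 / (4 * π)) * ((‖z‖ ^ 2) ^ (-(5 / 2 : ℝ)) * ‖z‖ ^ 2) +
          (3 / (4 * π)) * (‖z‖ ^ 2) ^ (-(3 / 2 : ℝ)) := by ring
    _ = 0 := by rw [e]; ring

/-- **`Γ` is harmonic on `ℝ³ ∖ {0}`** in Mathlib's vocabulary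
(`InnerProductSpace.HarmonicOnNhd`). [folklore] -/
theorem harmonicOnNhd_newtonKernel : HarmonicOnNhd newtonKernel ({0}ᶜ : Set ℝ³) := by
  intro z hz
  refine ⟨contDiffAt_newtonKernel hz, ?_⟩
  filter_upwards [isOpen_compl_singleton.mem_nhds hz] with w hw
  exact laplacian_newtonKernel hw

/-! ### Homogeneity and decay of the derivatives of `Γ` -/

/-- `Γ` is homogeneous of degree `-1` (in `zpow` form, all `z`). [folklore] -/
theorem newtonKernel_homogeneous (c : ℝ) (hc : 0 < c) (z : ℝ³) :
    newtonKernel (c • z) = c ^ (-1 : ℤ) • newtonKernel z := by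
  rw [newtonKernel_smul hc, zpow_neg_one, smul_eq_mul]

/-- `DΓ` is homogeneous of degree `-2`. [folklore] -/
theorem fderiv_newtonKernel_homogeneous (c : ℝ) (hc : 0 < c) (z : ℝ³) :
    fderiv ℝ newtonKernel (c • z) = c ^ (-2 : ℤ) • fderiv ℝ newtonKernel z := by
  rw [fderiv_homogeneous newtonKernel (-1) newtonKernel_homogeneous c hc z]
  norm_num

/-- `D²Γ` is homogeneous of degree `-3`. [folklore] -/
theorem fderiv2_newtonKernel_homogeneous (c : ℝ) (hc : 0 < c) (z : ℝ³) :
    fderiv ℝ (fderiv ℝ newtonKernel) (c • z) =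
      c ^ (-3 : ℤ) • fderiv ℝ (fderiv ℝ newtonKernel) z := by
  rw [fderiv_homogeneous _ (-2) fderiv_newtonKernel_homogeneous c hc z]
  norm_num

/-- `D³Γ` is homogeneous of degree `-4`. [folklore] -/
theorem fderiv3_newtonKernel_homogeneous (c : ℝ) (hc : 0 < c) (z : ℝ³) :
    fderiv ℝ (fderiv ℝ (fderiv ℝ newtonKernel)) (c • z) =
      c ^ (-4 : ℤ) • fderiv ℝ (fderiv ℝ (fderiv ℝ newtonKernel)) z := by
  rw [fderiv_homogeneous _ (-3) fderiv2_newtonKernel_homogeneous c hc z]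
  norm_num

/-- `D⁴Γ` is homogeneous of degree `-5`. [folklore] -/
theorem fderiv4_newtonKernel_homogeneous (c : ℝ) (hc : 0 < c) (z : ℝ³) :
    fderiv ℝ (fderiv ℝ (fderiv ℝ (fderiv ℝ newtonKernel))) (c • z) =
      c ^ (-5 : ℤ) • fderiv ℝ (fderiv ℝ (fderiv ℝ (fderiv ℝ newtonKernel))) z := by
  rw [fderiv_homogeneous _ (-4) fderiv3_newtonKernel_homogeneous c hc z]
  norm_num

/-- The `fderiv`-iterates of `Γ` are smooth off the origin. [folklore] -/
theorem contDiffOn_fderiv_newtonKernel {n : WithTop ℕ∞} :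
    ContDiffOn ℝ n (fderiv ℝ newtonKernel) {0}ᶜ :=
  (contDiffOn_newtonKernel (n := n + 1)).fderiv_of_isOpen isOpen_compl_singleton le_rfl

/-- `D²Γ` is smooth off the origin. [folklore] -/
theorem contDiffOn_fderiv2_newtonKernel {n : WithTop ℕ∞} :
    ContDiffOn ℝ n (fderiv ℝ (fderiv ℝ newtonKernel)) {0}ᶜ :=
  (contDiffOn_fderiv_newtonKernel (n := n + 1)).fderiv_of_isOpen isOpen_compl_singleton le_rfl

/-- `D³Γ` is smooth off the origin. [folklore] -/
theorem contDiffOn_fderiv3_newtonKernel {n : WithTop ℕ∞} :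
    ContDiffOn ℝ n (fderiv ℝ (fderiv ℝ (fderiv ℝ newtonKernel))) {0}ᶜ :=
  (contDiffOn_fderiv2_newtonKernel (n := n + 1)).fderiv_of_isOpen isOpen_compl_singleton le_rfl

/-- `D⁴Γ` is smooth off the origin. [folklore] -/
theorem contDiffOn_fderiv4_newtonKernel {n : WithTop ℕ∞} :
    ContDiffOn ℝ n (fderiv ℝ (fderiv ℝ (fderiv ℝ (fderiv ℝ newtonKernel)))) {0}ᶜ :=
  (contDiffOn_fderiv3_newtonKernel (n := n + 1)).fderiv_of_isOpen isOpen_compl_singleton le_rfl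

/-! ### The near/far splitting `Γ = Γ₀ + Γ∞` -/

/-- The **near-field kernel** `Γ₀ = θΓ` (compactly supported, singular at the origin; in `L¹`,
see `NewtonPotential`), `θ = radialCutoff r₀ r₁`. [folklore] -/
def newtonNear (r₀ r₁ : ℝ) (z : ℝ³) : ℝ := radialCutoff r₀ r₁ z * newtonKernel z

/-- The **far-field kernel** `Γ∞ = (1 - θ)Γ` (smooth, all derivatives bounded). [folklore] -/
def newtonFar (r₀ r₁ : ℝ) (z : ℝ³) : ℝ := (1 - radialCutoff r₀ r₁ z) * newtonKernel z

/-- `λ = ΔΓ∞`, a smooth function with topological support in the annulus `r₀ ≤ |z| ≤ r₁`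
(`tsupport_newtonFarLaplacian_subset_annulus`); the identity `Δ(θΓ) = δ₀ - λ` in the sense of
distributions is not proved here (its integrated form is in `NewtonPotential`). [folklore] -/
def newtonFarLaplacian (r₀ r₁ : ℝ) : ℝ³ → ℝ := Δ (newtonFar r₀ r₁)

variable {r₀ r₁ : ℝ}

/-- `Γ₀ + Γ∞ = Γ`. [folklore] -/
theorem newtonNear_add_newtonFar (r₀ r₁ : ℝ) (z : ℝ³) :
    newtonNear r₀ r₁ z + newtonFar r₀ r₁ z = newtonKernel z := by
  rw [newtonNear, newtonFar]; ring

/-- `Γ₀ = Γ - Γ∞`. [folklore] -/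
theorem newtonNear_eq_sub (r₀ r₁ : ℝ) :
    newtonNear r₀ r₁ = fun z => newtonKernel z - newtonFar r₀ r₁ z := by
  funext z; rw [newtonNear, newtonFar]; ring

/-- `Γ∞ = Γ - Γ₀`. [folklore] -/
theorem newtonFar_eq_sub (r₀ r₁ : ℝ) :
    newtonFar r₀ r₁ = fun z => newtonKernel z - newtonNear r₀ r₁ z := by
  funext z; rw [newtonNear, newtonFar]; ring

/-- `|Γ₀(z)| ≤ (4π|z|)⁻¹`. [folklore] -/
theorem abs_newtonNear_le (r₀ r₁ : ℝ) (z : ℝ³) : |newtonNear r₀ r₁ z| ≤ (4 * π * ‖z‖)⁻¹ := by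
  rw [newtonNear, abs_mul, ← abs_newtonKernel]
  exact mul_le_of_le_one_left (abs_nonneg _) (abs_radialCutoff_le_one _ _ _)

/-- `|Γ∞(z)| ≤ (4π|z|)⁻¹`. [folklore] -/
theorem abs_newtonFar_le (r₀ r₁ : ℝ) (z : ℝ³) : |newtonFar r₀ r₁ z| ≤ (4 * π * ‖z‖)⁻¹ := by
  rw [newtonFar, abs_mul, ← abs_newtonKernel]
  refine mul_le_of_le_one_left (abs_nonneg _) ?_
  rw [abs_le]
  constructor <;> linarith [radialCutoff_nonneg r₀ r₁ z, radialCutoff_le_one r₀ r₁ z]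

/-- `Γ₀ = 0` off the open ball of radius `r₁`. [folklore] -/
theorem newtonNear_eq_zero (h₀ : 0 ≤ r₀) (h₁ : r₀ < r₁) {z : ℝ³} (hz : r₁ ≤ ‖z‖) :
    newtonNear r₀ r₁ z = 0 := by
  rw [newtonNear, radialCutoff_eq_zero h₀ h₁ hz, zero_mul]

/-- `Γ₀ = Γ` on the closed ball of radius `r₀`. [folklore] -/
theorem newtonNear_eq_newtonKernel (h₀ : 0 ≤ r₀) (h₁ : r₀ < r₁) {z : ℝ³} (hz : ‖z‖ ≤ r₀) :
    newtonNear r₀ r₁ z = newtonKernel z := by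
  rw [newtonNear, radialCutoff_eq_one h₀ h₁ hz, one_mul]

/-- `Γ∞ = 0` on the closed ball of radius `r₀`. [folklore] -/
theorem newtonFar_eq_zero (h₀ : 0 ≤ r₀) (h₁ : r₀ < r₁) {z : ℝ³} (hz : ‖z‖ ≤ r₀) :
    newtonFar r₀ r₁ z = 0 := by
  rw [newtonFar, radialCutoff_eq_one h₀ h₁ hz, sub_self, zero_mul]

/-- `Γ∞ = Γ` off the open ball of radius `r₁`. [folklore] -/
theorem newtonFar_eq_newtonKernel (h₀ : 0 ≤ r₀) (h₁ : r₀ < r₁) {z : ℝ³} (hz : r₁ ≤ ‖z‖) :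
    newtonFar r₀ r₁ z = newtonKernel z := by
  rw [newtonFar, radialCutoff_eq_zero h₀ h₁ hz, sub_zero, one_mul]

/-- The topological support of `Γ₀` lies in the closed ball of radius `r₁`. [folklore] -/
theorem tsupport_newtonNear_subset (h₀ : 0 ≤ r₀) (h₁ : r₀ < r₁) :
    tsupport (newtonNear r₀ r₁) ⊆ closedBall (0 : ℝ³) r₁ := by
  refine closure_minimal (fun z hz => ?_) isClosed_closedBall
  rw [mem_closedBall_zero_iff]
  by_contra h
  exact hz (newtonNear_eq_zero h₀ h₁ (not_le.1 h).le)

/-- `Γ₀` has compact support. [folklore] -/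
theorem hasCompactSupport_newtonNear (h₀ : 0 ≤ r₀) (h₁ : r₀ < r₁) :
    HasCompactSupport (newtonNear r₀ r₁) :=
  (isCompact_closedBall (0 : ℝ³) r₁).of_isClosed_subset isClosed_closure
    (tsupport_newtonNear_subset h₀ h₁)

/-- `Γ∞ = 0` near every point of the open ball of radius `r₀`. [folklore] -/
theorem newtonFar_eventuallyEq_zero (h₀ : 0 ≤ r₀) (h₁ : r₀ < r₁) {z : ℝ³} (hz : ‖z‖ < r₀) :
    newtonFar r₀ r₁ =ᶠ[𝓝 z] fun _ => 0 := by
  filter_upwards [radialCutoff_eventuallyEq_one (E := ℝ³) h₀ h₁ hz] with w hw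
  rw [newtonFar, hw, sub_self, zero_mul]

/-- `Γ∞ = Γ` near every point off the closed ball of radius `r₁`. [folklore] -/
theorem newtonFar_eventuallyEq_newtonKernel (h₀ : 0 ≤ r₀) (h₁ : r₀ < r₁) {z : ℝ³}
    (hz : r₁ < ‖z‖) : newtonFar r₀ r₁ =ᶠ[𝓝 z] newtonKernel := by
  filter_upwards [radialCutoff_eventuallyEq_zero (E := ℝ³) h₀ h₁ hz] with w hw
  rw [newtonFar, hw, sub_zero, one_mul]

/-- `Γ₀ = Γ` near every point of the open ball of radius `r₀`. [folklore] -/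
theorem newtonNear_eventuallyEq_newtonKernel (h₀ : 0 ≤ r₀) (h₁ : r₀ < r₁) {z : ℝ³}
    (hz : ‖z‖ < r₀) : newtonNear r₀ r₁ =ᶠ[𝓝 z] newtonKernel := by
  filter_upwards [radialCutoff_eventuallyEq_one (E := ℝ³) h₀ h₁ hz] with w hw
  rw [newtonNear, hw, one_mul]

/-- `Γ₀` is smooth off the origin. [folklore] -/
theorem contDiffAt_newtonNear (r₀ r₁ : ℝ) {z : ℝ³} (hz : z ≠ 0) {n : ℕ∞} :
    ContDiffAt ℝ n (newtonNear r₀ r₁) z :=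
  ((radialCutoff_contDiff (E' := ℝ³) r₀ r₁ (n := n)).contDiffAt).mul
    (contDiffAt_newtonKernel hz)

/-- **`Γ∞` is smooth** (it vanishes near the origin). [folklore] -/
theorem contDiff_newtonFar (h₀ : 0 < r₀) (h₁ : r₀ < r₁) {n : ℕ∞} :
    ContDiff ℝ n (newtonFar r₀ r₁) := by
  refine contDiff_iff_contDiffAt.2 fun z => ?_
  by_cases hz : ‖z‖ < r₀
  · exact (contDiffAt_const (c := (0 : ℝ))).congr_of_eventuallyEq
      (newtonFar_eventuallyEq_zero h₀.le h₁ hz)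
  · have hz0 : z ≠ 0 := by
      rintro rfl
      exact hz (by simpa using h₀)
    exact (contDiffAt_const.sub
      (radialCutoff_contDiff (E' := ℝ³) r₀ r₁ (n := n)).contDiffAt).mul
      (contDiffAt_newtonKernel hz0)

/-- `λ = ΔΓ∞` is smooth. [folklore] -/
theorem contDiff_newtonFarLaplacian (h₀ : 0 < r₀) (h₁ : r₀ < r₁) {n : ℕ∞} :
    ContDiff ℝ n (newtonFarLaplacian r₀ r₁) :=
  contDiff_laplacian (by exact_mod_cast contDiff_newtonFar h₀ h₁ (n := n + 2))

/-- `λ = ΔΓ∞` is continuous. [folklore] -/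
theorem continuous_newtonFarLaplacian (h₀ : 0 < r₀) (h₁ : r₀ < r₁) :
    Continuous (newtonFarLaplacian r₀ r₁) :=
  (contDiff_newtonFarLaplacian h₀ h₁ (n := 0)).continuous

/-- `λ = 0` on the open ball of radius `r₀` (where `Γ∞ = 0`). [folklore] -/
theorem newtonFarLaplacian_eq_zero_of_lt (h₀ : 0 ≤ r₀) (h₁ : r₀ < r₁) {z : ℝ³}
    (hz : ‖z‖ < r₀) : newtonFarLaplacian r₀ r₁ z = 0 := by
  rw [newtonFarLaplacian, (laplacian_congr_nhds (newtonFar_eventuallyEq_zero h₀ h₁ hz)).eq_of_nhds,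
    InnerProductSpace.laplacian_const, Pi.zero_apply]

/-- `λ = 0` off the closed ball of radius `r₁` (where `Γ∞ = Γ` is harmonic). [folklore] -/
theorem newtonFarLaplacian_eq_zero_of_gt (h₀ : 0 ≤ r₀) (h₁ : r₀ < r₁) {z : ℝ³}
    (hz : r₁ < ‖z‖) : newtonFarLaplacian r₀ r₁ z = 0 := by
  have hz0 : z ≠ 0 := by
    rintro rfl
    rw [norm_zero] at hz
    linarith
  rw [newtonFarLaplacian,
    (laplacian_congr_nhds (newtonFar_eventuallyEq_newtonKernel h₀ h₁ hz)).eq_of_nhds,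
    laplacian_newtonKernel hz0]

/-- The topological support of `λ` lies in the closed ball of radius `r₁`. [folklore] -/
theorem tsupport_newtonFarLaplacian_subset (h₀ : 0 ≤ r₀) (h₁ : r₀ < r₁) :
    tsupport (newtonFarLaplacian r₀ r₁) ⊆ closedBall (0 : ℝ³) r₁ := by
  refine closure_minimal (fun z hz => ?_) isClosed_closedBall
  rw [mem_closedBall_zero_iff]
  by_contra h
  exact hz (newtonFarLaplacian_eq_zero_of_gt h₀ h₁ (not_le.1 h))

/-- `λ` has compact support. [folklore] -/
theorem hasCompactSupport_newtonFarLaplacian (h₀ : 0 ≤ r₀) (h₁ : r₀ < r₁) :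
    HasCompactSupport (newtonFarLaplacian r₀ r₁) :=
  (isCompact_closedBall (0 : ℝ³) r₁).of_isClosed_subset isClosed_closure
    (tsupport_newtonFarLaplacian_subset h₀ h₁)

/-- The topological support of `λ` lies in the closed annulus `r₀ ≤ |z| ≤ r₁`. [folklore] -/
theorem tsupport_newtonFarLaplacian_subset_annulus (h₀ : 0 ≤ r₀) (h₁ : r₀ < r₁) :
    tsupport (newtonFarLaplacian r₀ r₁) ⊆ closedBall (0 : ℝ³) r₁ \ ball 0 r₀ := by
  refine closure_minimal (fun z hz => ?_) (isClosed_closedBall.sdiff isOpen_ball)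
  rw [Set.mem_sdiff, mem_closedBall_zero_iff, mem_ball_zero_iff, not_lt]
  by_contra h
  rw [not_and_or, not_le, not_le] at h
  rcases h with h | h
  · exact hz (newtonFarLaplacian_eq_zero_of_gt h₀ h₁ h)
  · exact hz (newtonFarLaplacian_eq_zero_of_lt h₀ h₁ h)

/-- **`ΔΓ₀ = -λ` off the origin** (`Γ₀ = Γ - Γ∞` and `ΔΓ = 0` there). [folklore] -/
theorem laplacian_newtonNear (h₀ : 0 < r₀) (h₁ : r₀ < r₁) {z : ℝ³} (hz : z ≠ 0) :
    Δ (newtonNear r₀ r₁) z = -newtonFarLaplacian r₀ r₁ z := by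
  rw [newtonNear_eq_sub]
  have h1 : ContDiffAt ℝ 2 newtonKernel z := contDiffAt_newtonKernel hz
  have h2 : ContDiffAt ℝ 2 (newtonFar r₀ r₁) z :=
    (contDiff_newtonFar h₀ h₁ (n := 2)).contDiffAt
  have := h1.laplacian_sub h2
  rw [show (newtonKernel - newtonFar r₀ r₁) = fun z => newtonKernel z - newtonFar r₀ r₁ z from rfl]
    at this
  rw [this, laplacian_newtonKernel hz, zero_sub, newtonFarLaplacian]

/-! ### Boundedness of the derivatives of `Γ∞` -/

/-- Off the closed ball of radius `r₁`, every `fderiv`-iterate of `Γ∞` agrees with that of `Γ`.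
[folklore] -/
theorem newtonFar_fderiv_iterates_eq (h₀ : 0 ≤ r₀) (h₁ : r₀ < r₁) {z : ℝ³} (hz : r₁ < ‖z‖) :
    newtonFar r₀ r₁ z = newtonKernel z ∧
    fderiv ℝ (newtonFar r₀ r₁) z = fderiv ℝ newtonKernel z ∧
    fderiv ℝ (fderiv ℝ (newtonFar r₀ r₁)) z = fderiv ℝ (fderiv ℝ newtonKernel) z ∧
    fderiv ℝ (fderiv ℝ (fderiv ℝ (newtonFar r₀ r₁))) z =
      fderiv ℝ (fderiv ℝ (fderiv ℝ newtonKernel)) z ∧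
    fderiv ℝ (fderiv ℝ (fderiv ℝ (fderiv ℝ (newtonFar r₀ r₁)))) z =
      fderiv ℝ (fderiv ℝ (fderiv ℝ (fderiv ℝ newtonKernel))) z := by
  have e0 := newtonFar_eventuallyEq_newtonKernel h₀ h₁ hz
  have e1 := e0.fderiv (𝕜 := ℝ)
  have e2 := e1.fderiv (𝕜 := ℝ)
  have e3 := e2.fderiv (𝕜 := ℝ)
  have e4 := e3.fderiv (𝕜 := ℝ)
  exact ⟨e0.eq_of_nhds, e1.eq_of_nhds, e2.eq_of_nhds, e3.eq_of_nhds, e4.eq_of_nhds⟩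

/-- A continuous function on `ℝ³` agreeing off a ball with a function bounded off that ball is
bounded. [folklore] -/
theorem exists_bound_of_eqOn_far {F : Type*} [NormedAddCommGroup F] {Ψ Φ : ℝ³ → F}
    (hΨ : Continuous Ψ) {r : ℝ} (heq : ∀ z, r < ‖z‖ → Ψ z = Φ z)
    (hΦ : ∃ M, ∀ z, r + 1 ≤ ‖z‖ → ‖Φ z‖ ≤ M) : ∃ M, ∀ z, ‖Ψ z‖ ≤ M := by
  obtain ⟨M₁, hM₁⟩ := hΦ
  obtain ⟨M₂, hM₂⟩ := (isCompact_closedBall (0 : ℝ³) (r + 1)).exists_bound_of_continuousOn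
    hΨ.continuousOn
  refine ⟨max M₁ M₂, fun z => ?_⟩
  by_cases hz : ‖z‖ ≤ r + 1
  · exact (hM₂ z (mem_closedBall_zero_iff.2 hz)).trans (le_max_right _ _)
  · rw [not_le] at hz
    rw [heq z (by linarith)]
    exact (hM₁ z hz.le).trans (le_max_left _ _)

/-- **All `fderiv`-iterates of `Γ∞` up to order four are bounded** (continuity on a large ball,
homogeneity of the derivatives of `Γ` outside). [folklore] -/
theorem exists_bound_newtonFar_derivs (h₀ : 0 < r₀) (h₁ : r₀ < r₁) :
    (∃ M, ∀ z, ‖newtonFar r₀ r₁ z‖ ≤ M) ∧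
    (∃ M, ∀ z, ‖fderiv ℝ (newtonFar r₀ r₁) z‖ ≤ M) ∧
    (∃ M, ∀ z, ‖fderiv ℝ (fderiv ℝ (newtonFar r₀ r₁)) z‖ ≤ M) ∧
    (∃ M, ∀ z, ‖fderiv ℝ (fderiv ℝ (fderiv ℝ (newtonFar r₀ r₁))) z‖ ≤ M) ∧
    (∃ M, ∀ z, ‖fderiv ℝ (fderiv ℝ (fderiv ℝ (fderiv ℝ (newtonFar r₀ r₁)))) z‖ ≤ M) := by
  have hr : 0 < r₁ + 1 := by linarith
  have hF : ContDiff ℝ 4 (newtonFar r₀ r₁) := contDiff_newtonFar h₀ h₁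
  have hF1 : ContDiff ℝ 3 (fderiv ℝ (newtonFar r₀ r₁)) :=
    hF.fderiv_right (m := 3) (by norm_num)
  have hF2 : ContDiff ℝ 2 (fderiv ℝ (fderiv ℝ (newtonFar r₀ r₁))) :=
    hF1.fderiv_right (m := 2) (by norm_num)
  have hF3 : ContDiff ℝ 1 (fderiv ℝ (fderiv ℝ (fderiv ℝ (newtonFar r₀ r₁)))) :=
    hF2.fderiv_right (m := 1) (by norm_num)
  have hF4 : ContDiff ℝ 0 (fderiv ℝ (fderiv ℝ (fderiv ℝ (fderiv ℝ (newtonFar r₀ r₁))))) :=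
    hF3.fderiv_right (m := 0) (by norm_num)
  have heq := fun z (hz : r₁ < ‖z‖) => newtonFar_fderiv_iterates_eq h₀.le h₁ hz
  refine ⟨?_, ?_, ?_, ?_, ?_⟩
  · exact exists_bound_of_eqOn_far hF.continuous (fun z hz => (heq z hz).1)
      (exists_bound_of_homogeneous _ (-1) (by norm_num) newtonKernel_homogeneous
        (contDiffOn_newtonKernel (n := 0)).continuousOn hr)
  · exact exists_bound_of_eqOn_far hF1.continuous (fun z hz => (heq z hz).2.1)
      (exists_bound_of_homogeneous _ (-2) (by norm_num) fderiv_newtonKernel_homogeneous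
        (contDiffOn_fderiv_newtonKernel (n := 0)).continuousOn hr)
  · exact exists_bound_of_eqOn_far hF2.continuous (fun z hz => (heq z hz).2.2.1)
      (exists_bound_of_homogeneous _ (-3) (by norm_num) fderiv2_newtonKernel_homogeneous
        (contDiffOn_fderiv2_newtonKernel (n := 0)).continuousOn hr)
  · exact exists_bound_of_eqOn_far hF3.continuous (fun z hz => (heq z hz).2.2.2.1)
      (exists_bound_of_homogeneous _ (-4) (by norm_num) fderiv3_newtonKernel_homogeneous
        (contDiffOn_fderiv3_newtonKernel (n := 0)).continuousOn hr)
  · exact exists_bound_of_eqOn_far hF4.continuous (fun z hz => (heq z hz).2.2.2.2)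
      (exists_bound_of_homogeneous _ (-5) (by norm_num) fderiv4_newtonKernel_homogeneous
        (contDiffOn_fderiv4_newtonKernel (n := 0)).continuousOn hr)

end Newton

end Literature.Analysis.FluidPDE

end
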